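import Summits.AtomisticToContinuum.HydrodynamicLimit.Theorems.OneFlightGossipEngineCollisionActivityTailsEndpointTails
import Literature.Analysis.FluidPDE.HardSphereCollisionRecord
import HarnessLib

/-!
# `TransferActivityTails` (stmt-AtomisticToContinuum-16624), line `IdeatorOneSketch`: stub `stub_collisionSumMono`

Monotonicity of window collision sums on the good set: for a good datum `z ∈ Φ.good` the collision sum of the
orbit over a bounded window `(a, b]` is an honest finite sum over the records
`HardSphereCollisionRecord.ofConfig … (Φ_t z) t k l` (finitely many collision times in the window,
`HardSphereFlow.finite_collisionTimes_inter`), hence monotone in the functional along those records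
(`collisionPairSum_mono`).  Off the good set the `finsum` junk value `0` breaks monotonicity, whence the
goodness hypothesis in the registered statement `CollisionSumMono`.
-/

noncomputable section

open MeasureTheory Set Filter Topology
open scoped ENNReal InnerProductSpace BigOperators

namespace Summit.AtomisticToContinuum.HydrodynamicLimit.Theorems.TransferActivityTailsCollisionSumMono

open Literature.MathematicalPhysics.KineticTheory Literature.Analysis.FluidPDE
open Summit.AtomisticToContinuum.HydrodynamicLimit.Theorems.CollisionActivityTailsEndpointTails
  (Flow Cfg window tailFn tailFn_of_lt tailFn_of_le measurable_tailFn ae_mem_good_localGibbsLaw)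

/-! ## The statement (verbatim from the line skeleton) -/

/-- Collision records of `N + 1` spheres on `𝕋³` — registered stub signature of line IdeatorOneSketch, crux
TransferActivityTails (stmt-AtomisticToContinuum-16624) — route-internal, not a cited fact. -/
abbrev Rec (N : ℕ) : Type := HardSphereCollisionRecord (Fin 3) T3 (N + 1)

/-- Monotonicity of window collision sums on the good set — registered stub signature of line IdeatorOneSketch,
crux TransferActivityTails (stmt-AtomisticToContinuum-16624) — route-internal, not a cited fact. -/
def CollisionSumMono : Prop :=
  ∀ (σ : ℝ) (N : ℕ) (Φ : Flow σ N) (z : Cfg N), z ∈ Φ.good → ∀ (a b : ℝ) (F G : Rec N → ℝ),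
    (∀ (t : ℝ) (k l : Fin (N + 1)),
      F (HardSphereCollisionRecord.ofConfig (Torus.geometry (Fin 3)) (hsDiameter σ N) (Φ.flow t z) t k l) ≤
        G (HardSphereCollisionRecord.ofConfig (Torus.geometry (Fin 3)) (hsDiameter σ N) (Φ.flow t z) t k l)) →
    Φ.collisionSum (Set.Ioc a b) F z ≤ Φ.collisionSum (Set.Ioc a b) G z

/-! ## The proof -/

/-- Stub 2 (registered): monotonicity of window collision sums on the good set.  On the good set the window
`(a, b] ⊆ [a, b]` carries finitely many collision times (`HardSphereFlow.finite_collisionTimes_inter`), so both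
collision sums are finite sums over the same collision times and contact pairs (`collisionPairSum_mono`), and the
hypothesis compares the summands record by record. [folklore] -/
theorem stub_collisionSumMono : CollisionSumMono := by
  intro σ N Φ z hz a b F G hFG
  -- adapted from `ClampedCurrentsDockTransferTails.collisionSum_transfer_eq_add` (finite-sum form on the good set)
  have hfin := Φ.finite_collisionTimes_inter hz (S := Set.Ioc a b) Set.Ioc_subset_Icc_self
  simp only [HardSphereFlow.collisionSum_eq, collisionSum_eq_collisionPairSum]
  exact collisionPairSum_mono hfin fun t _ p _ => hFG t p.1 p.2

end Summit.AtomisticToContinuum.HydrodynamicLimit.Theorems.TransferActivityTailsCollisionSumMono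

end
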